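import Mathlib.Geometry.Manifold.PartitionOfUnity
import Literature.Geometry.Lorentzian.StationaryOrbitProjection
import HarnessLib

/-!
# A global time function: `t : M → ℝ` with `t(θₛ y) = t(y) + s`
(Anderson 2000, §0, (0.1): `g_M = -u²(dt + θ)² + π^* g_S` — the coordinate `t`; the principal
`ℝ`-bundle `π : M → S` is trivial)

M. T. Anderson, *On stationary vacuum solutions to the Einstein equations*, Ann. Henri Poincaré 1
(2000), §0 writes a chronological stationary space-time globally as
`g_M = -u²(dt + θ)² + π^* g_S` (0.1), which presupposes a global function `t : M → ℝ` increasing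
at unit rate along the orbits of the Killing flow (`X(t) = 1`), i.e. a trivialisation of the
principal `ℝ`-bundle `π : M → S` ("principal `ℝ`-bundles over paracompact bases are trivial").
This file constructs such a `t` for the flow `θ` of a chronological stationary space-time, from
the slices of `StationaryOrbitSpaceManifold.lean` and a smooth partition of unity on the orbit
manifold `S`:

* `SliceData.tubeTime`, `SliceData.eq_flow_tubeTime_param` — on the tube `T` of a slice at `p`,
  `y = θ(t_T(y), σ(coord y))` with `t_T = ℓ ∘ (ψ - ψ p)` smooth;
* `SliceData.satSet`, `SliceData.satTime` — on the **saturation** `π⁻¹(π(T)) = ⋃ₛ θₛ(σ(dom))`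
  the **local time** `t_p(θ(s, σ u)) = s` is well defined (`flow_param_injective`, from the
  `once` property of slices), satisfies `t_p(θ(s, y)) = t_p(y) + s` (`satTime_flow`), and is `C^∞`
  (`contMDiffAt_satTime`: locally `t_p(y) = s₀ + t_T(θ(-s₀, y))`); the saturation is open and is
  the preimage of the chart source (`mem_satSet_iff`);
* `IsStationaryKilling.exists_timeFunction` — **gluing**: with a smooth partition of unity
  `(ρ_p)` on `S` subordinate to the chart sources, `t := ∑ᶠ_p (ρ_p ∘ π) · t_p` is `C^∞` on `M` and
  `t(θ(s, y)) = t(y) + s` for all `s, y` (the `ρ_p ∘ π` are flow invariant and sum to `1`);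
* `Spacetime.IsStationaryKilling.exists_timeFunction` — the bundled four-dimensional form.

Everything is proved; no definitions of global objects beyond the local times, no named facts.

## References

* M. T. Anderson, Ann. Henri Poincaré 1 (2000) 977–994, arXiv:gr-qc/0001091, §0, (0.1) (key
  `Anderson2000`).
* R. Geroch, J. Math. Phys. 12 (1971) 918–924, App. A (the space of orbits; global time
  coordinates of stationary space-times) (key `Geroch1971`).
-/

noncomputable section

open Bundle Set Filter Function Manifold TopologicalSpace
open scoped ContDiff Topology Manifold

namespace Literature.Geometry.Lorentzian

namespace LorentzianMetric

namespace SliceData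

variable {E : Type*} [NormedAddCommGroup E] [NormedSpace ℝ E] {M : Type*} [TopologicalSpace M]
  [ChartedSpace E M] {X : Π x : M, TangentSpace 𝓘(ℝ, E) x} {θ : ℝ × M → M}
  {F : Type*} [NormedAddCommGroup F] [NormedSpace ℝ F] {p : M} (d : SliceData X θ F p)

/-! ### The time coordinate of the tube -/

/-- The **flow-box time** of a point of the tube: `t_T(y) = ℓ(ψ y - ψ p)`. [folklore] -/
def tubeTime (y : M) : ℝ :=
  d.ℓ (d.ψ y - d.ψ p)

/-- `|t_T(y)| < ε` on the tube. [folklore] -/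
theorem abs_tubeTime_lt {y : M} (hy : y ∈ d.T) : |d.tubeTime y| < d.ε :=
  (d.retract y hy).1

/-- **Retraction to the slice**: `θ(-t_T(y), y) = σ(coord y)` for `y` in the tube. [folklore] -/
theorem flow_neg_tubeTime {y : M} (hy : y ∈ d.T) :
    θ (-d.tubeTime y, y) = d.param (d.coord y) := by
  simp only [tubeTime]
  rw [(d.retract y hy).2.2]
  simp only [param, coord, ContinuousLinearEquiv.symm_apply_apply, coe_proj]

/-- **Every point of the tube is a flow translate of its slice point**:
`y = θ(t_T(y), σ(coord y))`. [folklore] -/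
theorem eq_flow_tubeTime_param (hθ0 : ∀ q, θ (0, q) = q)
    (hθadd : ∀ t s q, θ (t, θ (s, q)) = θ (t + s, q)) {y : M} (hy : y ∈ d.T) :
    y = θ (d.tubeTime y, d.param (d.coord y)) := by
  rw [← d.flow_neg_tubeTime hy, hθadd, add_neg_cancel, hθ0]

/-- The flow-box time is `C^∞` on the tube. [folklore] -/
theorem contMDiffOn_tubeTime : ContMDiffOn 𝓘(ℝ, E) 𝓘(ℝ, ℝ) ∞ d.tubeTime d.T := by
  have hψ : ContMDiffOn 𝓘(ℝ, E) 𝓘(ℝ, E) ∞ d.ψ d.ψ.source := contMDiffOn_of_mem_maximalAtlas d.hψ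
  have h1 : ContMDiffOn 𝓘(ℝ, E) 𝓘(ℝ, E) ∞ (fun y ↦ d.ψ y - d.ψ p) d.T :=
    (hψ.mono d.hTψ).sub contMDiffOn_const
  have h2 : ContMDiff 𝓘(ℝ, E) 𝓘(ℝ, ℝ) ∞ (d.ℓ : E → ℝ) := by
    rw [contMDiff_iff_contDiff]
    exact d.ℓ.contDiff
  exact h2.comp_contMDiffOn h1

/-! ### The saturation of the slice and its time function -/

/-- The **saturation** of the slice: all flow translates `θ(s, σ u)`, `u ∈ dom`, `s ∈ ℝ` — the
preimage `π⁻¹(π(T))` of the chart source (`mem_satSet_iff`). [folklore] -/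
def satSet : Set M :=
  {y | ∃ s : ℝ, ∃ u ∈ d.dom, θ (s, d.param u) = y}

/-- Flow translates of slice points are in the saturation. [folklore] -/
theorem flow_param_mem_satSet (s : ℝ) {u : F} (hu : u ∈ d.dom) : θ (s, d.param u) ∈ d.satSet :=
  ⟨s, u, hu, rfl⟩

/-- The tube lies in the saturation. [folklore] -/
theorem mem_satSet_of_mem_T (hθ0 : ∀ q, θ (0, q) = q)
    (hθadd : ∀ t s q, θ (t, θ (s, q)) = θ (t + s, q)) {y : M} (hy : y ∈ d.T) : y ∈ d.satSet :=
  ⟨d.tubeTime y, d.coord y, d.coord_mem_dom hy, (d.eq_flow_tubeTime_param hθ0 hθadd hy).symm⟩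

/-- The saturation is flow invariant. [folklore] -/
theorem flow_mem_satSet (hθadd : ∀ t s q, θ (t, θ (s, q)) = θ (t + s, q)) {y : M}
    (hy : y ∈ d.satSet) (s : ℝ) : θ (s, y) ∈ d.satSet := by
  obtain ⟨s₀, u, hu, rfl⟩ := hy
  exact ⟨s + s₀, u, hu, by rw [hθadd]⟩

/-- **Uniqueness of the representation `θ(s, σ u)`** (the `once` property of the slice and the
group law): `θ(s, σ u) = θ(s', σ u')` forces `s = s'` and `u = u'`. [folklore] -/
theorem flow_param_injective (hθ0 : ∀ q, θ (0, q) = q)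
    (hθadd : ∀ t s q, θ (t, θ (s, q)) = θ (t + s, q)) {s s' : ℝ} {u u' : F} (hu : u ∈ d.dom)
    (hu' : u' ∈ d.dom) (h : θ (s, d.param u) = θ (s', d.param u')) : s = s' ∧ u = u' := by
  have h1 : θ (-s' + s, d.param u) = d.param u' := by
    have := congrArg (fun q ↦ θ (-s', q)) h
    simpa only [hθadd, neg_add_cancel, hθ0] using this
  have h2 := d.once _ hu (d.apply_coe_symm u) _ hu' (d.apply_coe_symm u') (-s' + s) h1
  refine ⟨by linarith [h2.1], ?_⟩
  have h3 : d.Φ.symm u = d.Φ.symm u' := Subtype.ext h2.2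
  simpa using congrArg d.Φ h3

open Classical in
/-- The **local time function** of the slice on its saturation: `t_p(θ(s, σ u)) = s`
(well defined by `flow_param_injective`; junk value `0` off the saturation). Anderson 2000, §0,
(0.1) (the coordinate `t` of a local trivialisation). [cite: Anderson2000, §0, (0.1)] -/
def satTime (y : M) : ℝ :=
  if h : y ∈ d.satSet then Classical.choose h else 0

/-- `t_p(θ(s, σ u)) = s`. [folklore] -/
theorem satTime_flow_param (hθ0 : ∀ q, θ (0, q) = q)
    (hθadd : ∀ t s q, θ (t, θ (s, q)) = θ (t + s, q)) (s : ℝ) {u : F} (hu : u ∈ d.dom) :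
    d.satTime (θ (s, d.param u)) = s := by
  have hmem : θ (s, d.param u) ∈ d.satSet := d.flow_param_mem_satSet s hu
  rw [satTime, dif_pos hmem]
  obtain ⟨u', hu', h'⟩ := Classical.choose_spec hmem
  exact (d.flow_param_injective hθ0 hθadd hu' hu h').1

/-- **The local time increases at unit rate along the flow**: `t_p(θ(s, y)) = t_p(y) + s` on
the saturation. [cite: Anderson2000, §0, (0.1)] -/
theorem satTime_flow (hθ0 : ∀ q, θ (0, q) = q)
    (hθadd : ∀ t s q, θ (t, θ (s, q)) = θ (t + s, q)) {y : M} (hy : y ∈ d.satSet) (s : ℝ) :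
    d.satTime (θ (s, y)) = d.satTime y + s := by
  obtain ⟨s₀, u, hu, rfl⟩ := hy
  rw [hθadd, d.satTime_flow_param hθ0 hθadd _ hu, d.satTime_flow_param hθ0 hθadd _ hu]
  ring

/-- On the tube the local time is the flow-box time. [folklore] -/
theorem satTime_of_mem_T (hθ0 : ∀ q, θ (0, q) = q)
    (hθadd : ∀ t s q, θ (t, θ (s, q)) = θ (t + s, q)) {y : M} (hy : y ∈ d.T) :
    d.satTime y = d.tubeTime y := by
  have h := d.satTime_flow_param hθ0 hθadd (d.tubeTime y) (d.coord_mem_dom hy)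
  rwa [← d.eq_flow_tubeTime_param hθ0 hθadd hy] at h

/-- **Local form of the local time**: near `θ(s₀, σ u₀)`, `t_p(y) = s₀ + t_T(θ(-s₀, y))`.
[folklore] -/
theorem satTime_eq_nhds (hθc : Continuous θ) (hθ0 : ∀ q, θ (0, q) = q)
    (hθadd : ∀ t s q, θ (t, θ (s, q)) = θ (t + s, q)) (s₀ : ℝ) {u₀ : F} (hu₀ : u₀ ∈ d.dom) :
    ∀ᶠ y in 𝓝 (θ (s₀, d.param u₀)),
      θ (-s₀, y) ∈ d.T ∧ d.satTime y = s₀ + d.tubeTime (θ (-s₀, y)) := by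
  have hcont : Continuous fun y : M ↦ θ (-s₀, y) :=
    hθc.comp (continuous_const.prodMk continuous_id)
  have h0 : θ (-s₀, θ (s₀, d.param u₀)) ∈ d.T := by
    rw [hθadd, neg_add_cancel, hθ0]
    exact (d.param_mem hu₀).2
  filter_upwards [(hcont.isOpen_preimage _ d.hTo).mem_nhds h0] with y hy
  have hyT : θ (-s₀, y) ∈ d.T := hy
  refine ⟨hyT, ?_⟩
  have e1 : θ (s₀, θ (-s₀, y)) = y := by rw [hθadd, add_neg_cancel, hθ0]
  rw [d.eq_flow_tubeTime_param hθ0 hθadd hyT, hθadd] at e1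
  conv_lhs => rw [← e1]
  exact d.satTime_flow_param hθ0 hθadd _ (d.coord_mem_dom hyT)

/-- The saturation is open. [folklore] -/
theorem isOpen_satSet (hθc : Continuous θ) (hθ0 : ∀ q, θ (0, q) = q)
    (hθadd : ∀ t s q, θ (t, θ (s, q)) = θ (t + s, q)) : IsOpen d.satSet := by
  rw [isOpen_iff_mem_nhds]
  rintro y ⟨s₀, u₀, hu₀, rfl⟩
  filter_upwards [d.satTime_eq_nhds hθc hθ0 hθadd s₀ hu₀] with y hy
  have h1 : θ (-s₀, y) ∈ d.satSet := d.mem_satSet_of_mem_T hθ0 hθadd hy.1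
  have h2 := d.flow_mem_satSet hθadd h1 s₀
  rwa [hθadd, add_neg_cancel, hθ0] at h2

/-- **The local time is `C^∞` on the saturation** (local form `s₀ + t_T ∘ θ_{-s₀}`).
[cite: Anderson2000, §0, (0.1)] -/
theorem contMDiffAt_satTime (hθ : ContMDiff (𝓘(ℝ, ℝ).prod 𝓘(ℝ, E)) 𝓘(ℝ, E) ∞ θ)
    (hθ0 : ∀ q, θ (0, q) = q) (hθadd : ∀ t s q, θ (t, θ (s, q)) = θ (t + s, q)) {y₀ : M}
    (hy₀ : y₀ ∈ d.satSet) : ContMDiffAt 𝓘(ℝ, E) 𝓘(ℝ, ℝ) ∞ d.satTime y₀ := by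
  obtain ⟨s₀, u₀, hu₀, rfl⟩ := hy₀
  have hev := d.satTime_eq_nhds hθ.continuous hθ0 hθadd s₀ hu₀
  have hθs : ContMDiff 𝓘(ℝ, E) 𝓘(ℝ, E) ∞ (fun y : M ↦ θ (-s₀, y)) :=
    hθ.comp (contMDiff_const.prodMk contMDiff_id)
  have h0 : θ (-s₀, θ (s₀, d.param u₀)) ∈ d.T := by
    rw [hθadd, neg_add_cancel, hθ0]
    exact (d.param_mem hu₀).2
  have hsm : ContMDiffAt 𝓘(ℝ, E) 𝓘(ℝ, ℝ) ∞ (fun y ↦ s₀ + d.tubeTime (θ (-s₀, y)))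
      (θ (s₀, d.param u₀)) :=
    contMDiffAt_const.add (ContMDiffAt.comp (g := d.tubeTime) (f := fun y : M ↦ θ (-s₀, y)) _
      (d.contMDiffOn_tubeTime.contMDiffAt (d.hTo.mem_nhds h0)) hθs.contMDiffAt)
  exact hsm.congr_of_eventuallyEq (hev.mono fun y hy ↦ hy.2)

/-- **The saturation is the preimage of the chart source**: `y ∈ π⁻¹(π(T))` iff `y = θ(s, σ u)`
for some `s` and `u ∈ dom`. [folklore] -/
theorem mem_satSet_iff [CompleteSpace E] [IsManifold 𝓘(ℝ, E) ∞ M] [T2Space M]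
    (hX1 : CMDiff 1 (T% X))
    (hθX : ∀ q, IsMIntegralCurve (fun t ↦ θ (t, q)) X) (hθ0 : ∀ q, θ (0, q) = q)
    (hθadd : ∀ t s q, θ (t, θ (s, q)) = θ (t + s, q)) {y : M} :
    y ∈ d.satSet ↔ orbitProj X y ∈ (d.chart hX1 hθX hθ0).source := by
  have hc : IsCompleteVectorField X := fun x ↦ ⟨fun t ↦ θ (t, x), hθX x, hθ0 x⟩
  rw [d.chart_source hX1 hθX hθ0]
  constructor
  · rintro ⟨s, u, hu, rfl⟩
    exact ⟨d.param u, (d.param_mem hu).2,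
      orbitProj_eq_of_mem X ⟨fun t ↦ θ (t, d.param u), hθX _, hθ0 _, s, rfl⟩⟩
  · rintro ⟨y', hy'T, hπ⟩
    obtain ⟨s, hs⟩ := (mem_stationaryOrbit_singleton_iff_exists_flow_eq hX1 hθX hθ0).1
      ((orbitProj_eq_iff X hX1 hc).1 hπ)
    rw [← hs]
    exact d.flow_mem_satSet hθadd (d.mem_satSet_of_mem_T hθ0 hθadd hy'T) s

end SliceData

/-! ### Gluing: a global time function -/

section TimeFunction

variable {E : Type*} [NormedAddCommGroup E] [NormedSpace ℝ E] [FiniteDimensional ℝ E]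
  [CompleteSpace E] {M : Type*} [TopologicalSpace M] [ChartedSpace E M]
  [IsManifold 𝓘(ℝ, E) ∞ M] [T2Space M]
  {g : LorentzianMetric 𝓘(ℝ, E) ∞ M} [g.HasLeviCivita] {τ : TimeOrientation g}
  {X : Π x : M, TangentSpace 𝓘(ℝ, E) x} {θ : ℝ × M → M}
  {F : Type*} [NormedAddCommGroup F] [NormedSpace ℝ F] [FiniteDimensional ℝ F]
  [SecondCountableTopology M]

/-- **A global time function for a chronological stationary space-time.** For the `C^∞` flow
`θ` of the stationary Killing field there is a `C^∞` function `t : M → ℝ` with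
`t(θ(s, y)) = t(y) + s` for all `s ∈ ℝ`, `y ∈ M` (`X(t) = 1`): the principal `ℝ`-bundle
`π : M → S` is trivial and `M ≅ ℝ × S` via `y ↦ (t y, π y)`; this is the coordinate `t` of
Anderson's global form `g_M = -u²(dt + θ)² + π^* g_S` (Anderson 2000, §0, (0.1)). Proof: glue
the local times `t_p` of the slices (`SliceData.satTime`) with a smooth partition of unity on the
orbit manifold `S` subordinate to the chart sources (Mathlib's
`SmoothPartitionOfUnity.exists_isSubordinate`), pulled back by `π`.
[cite: Anderson2000, §0, (0.1)] -/
theorem IsStationaryKilling.exists_timeFunction (h : g.IsStationaryKilling τ X univ)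
    (hchr : g.IsChronological τ) (hθ : ContMDiff (𝓘(ℝ, ℝ).prod 𝓘(ℝ, E)) 𝓘(ℝ, E) ∞ θ)
    (hθ0 : ∀ p, θ (0, p) = p) (hθadd : ∀ t s p, θ (t, θ (s, p)) = θ (t + s, p))
    (hθX : ∀ p, IsMIntegralCurve (fun t ↦ θ (t, p)) X)
    (hF : Module.finrank ℝ F + 1 = Module.finrank ℝ E) :
    ∃ t : M → ℝ, ContMDiff 𝓘(ℝ, E) 𝓘(ℝ, ℝ) ∞ t ∧ ∀ (s : ℝ) (y : M), t (θ (s, y)) = t y + s := by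
  have hθ2 : ContMDiff (𝓘(ℝ, ℝ).prod 𝓘(ℝ, E)) 𝓘(ℝ, E) 2 θ :=
    hθ.of_le (WithTop.coe_le_coe.mpr le_top)
  letI := h.orbitSpaceChartedSpace hchr hθ2 hθ0 hθadd hθX hF
  haveI := h.isManifold_orbitSpace hchr hθ hθ0 hθadd hθX hF
  haveI : T2Space (OrbitSpace X) := h.t2Space_orbitSpace hchr (WithTop.coe_le_coe.mpr le_top)
  haveI : SecondCountableTopology (OrbitSpace X) :=
    secondCountableTopology_orbitSpace X h.contMDiff_one h.isCompleteVectorField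
  haveI : LocallyCompactSpace (OrbitSpace X) := ChartedSpace.locallyCompactSpace F _
  -- the slices, their chart sources, and a subordinate smooth partition of unity on `S`
  set d : Π p : M, SliceData X θ F p := fun p ↦ h.sliceDataAt hchr hθ2 hθ0 hθadd hθX hF p with hd
  set U : M → Set (OrbitSpace X) := fun p ↦ ((d p).chart h.contMDiff_one hθX hθ0).source with hU
  have hUo : ∀ p, IsOpen (U p) := fun p ↦ ((d p).chart h.contMDiff_one hθX hθ0).open_source
  have hUc : (univ : Set (OrbitSpace X)) ⊆ ⋃ p, U p := by
    intro z _
    refine mem_iUnion.2 ⟨z.out, ?_⟩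
    have hm := (d z.out).mem_chart_source h.contMDiff_one hθX hθ0
    have hz : orbitProj X z.out = z := Quotient.out_eq z
    rw [hz] at hm
    exact hm
  obtain ⟨ρ, hρ⟩ := SmoothPartitionOfUnity.exists_isSubordinate 𝓘(ℝ, F) isClosed_univ U hUo hUc
  -- the glued time function
  refine ⟨fun y ↦ ∑ᶠ p, ρ p (orbitProj X y) * (d p).satTime y, ?_, ?_⟩
  · -- smoothness: a locally finite sum of smooth terms
    have hπ : ContMDiff 𝓘(ℝ, E) 𝓘(ℝ, F) ∞ (orbitProj X) :=
      h.contMDiff_orbitProj hchr hθ hθ0 hθadd hθX hF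
    refine contMDiff_finsum (fun p y ↦ ?_) ?_
    · by_cases hy : orbitProj X y ∈ tsupport (ρ p)
      · have hsat : y ∈ (d p).satSet :=
          ((d p).mem_satSet_iff h.contMDiff_one hθX hθ0 hθadd).2 (hρ p hy)
        exact (((ρ p).contMDiff.comp hπ) y).mul ((d p).contMDiffAt_satTime hθ hθ0 hθadd hsat)
      · -- off the support the term vanishes identically near `y`
        have hzero : ∀ᶠ y' in 𝓝 y, ρ p (orbitProj X y') * (d p).satTime y' = 0 := by
          have hopen : IsOpen ((tsupport (ρ p))ᶜ) := (isClosed_tsupport _).isOpen_compl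
          filter_upwards [((continuous_orbitProj X).isOpen_preimage _ hopen).mem_nhds hy]
            with y' hy'
          rw [image_eq_zero_of_notMem_tsupport hy', zero_mul]
        exact contMDiffAt_const.congr_of_eventuallyEq hzero
    · refine (ρ.locallyFinite.preimage_continuous (continuous_orbitProj X)).subset fun p ↦ ?_
      intro y hy
      simp only [mem_preimage, Function.mem_support, ne_eq] at hy ⊢
      exact fun h0 ↦ hy (by rw [h0, zero_mul])
  · -- the flow property, termwise
    intro s y
    have hπs : orbitProj X (θ (s, y)) = orbitProj X y :=
      (orbitProj_eq_of_mem X ⟨fun t ↦ θ (t, y), hθX y, hθ0 y, s, rfl⟩).symm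
    have hterm : ∀ p, ρ p (orbitProj X (θ (s, y))) * (d p).satTime (θ (s, y)) =
        ρ p (orbitProj X y) * (d p).satTime y + ρ p (orbitProj X y) * s := by
      intro p
      rw [hπs]
      by_cases hp : ρ p (orbitProj X y) = 0
      · simp [hp]
      · have hy : y ∈ (d p).satSet :=
          ((d p).mem_satSet_iff h.contMDiff_one hθX hθ0 hθadd).2
            (hρ p (subset_tsupport _ hp))
        rw [(d p).satTime_flow hθ0 hθadd hy s, mul_add]
    have hfin : (Function.support fun p ↦ ρ p (orbitProj X y)).Finite :=
      ρ.locallyFinite.point_finite (orbitProj X y)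
    have hfin1 : (Function.support fun p ↦ ρ p (orbitProj X y) * (d p).satTime y).Finite :=
      hfin.subset (Function.support_mul_subset_left _ _)
    have hfin2 : (Function.support fun p ↦ ρ p (orbitProj X y) * s).Finite :=
      hfin.subset (Function.support_mul_subset_left _ _)
    simp_rw [hterm]
    rw [finsum_add_distrib hfin1 hfin2, ← finsum_mul, ρ.sum_eq_one (mem_univ _), one_mul]

end TimeFunction

end LorentzianMetric

/-! ### The bundled form -/

namespace Spacetime

universe u

variable {𝓢 : Spacetime.{u} 4} [𝓢.metric.HasLeviCivita]
  {X : Π x : 𝓢.carrier, TangentSpace (𝓡 4) x}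

/-- **Anderson 2000, §0, (0.1), for a bundled spacetime: a global time function** — a `C^∞`
`t : M → ℝ` with `t(θ(s, y)) = t(y) + s` along the stationary flow `θ = hX.flow` of a
chronological stationary spacetime. [cite: Anderson2000, §0, (0.1)] -/
theorem IsStationaryKilling.exists_timeFunction (hX : 𝓢.IsStationaryKilling X univ)
    (hchr : 𝓢.metric.IsChronological 𝓢.timeOrientation) :
    ∃ t : 𝓢.carrier → ℝ, ContMDiff (𝓡 4) 𝓘(ℝ, ℝ) ∞ t ∧
      ∀ (s : ℝ) (y : 𝓢.carrier), t (hX.flow (s, y)) = t y + s :=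
  LorentzianMetric.IsStationaryKilling.exists_timeFunction (F := EuclideanSpace ℝ (Fin 3)) hX hchr
    hX.contMDiff_flow hX.flow_zero hX.flow_add hX.isMIntegralCurve_flow
    (by simp [finrank_euclideanSpace])

end Spacetime

end Literature.Geometry.Lorentzian

end
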